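/-
Origin: expansion seat `prover-pub-hodgecm-mc-carch-1-g5-0`, handover #CA55 2026-08-20T12:03:16Z md5 53c2a2db991e (177 l., 13 decls; NEW additive leaf; imports #CA54 + #CA53 (this kit) + RUN-45 #CA35 Model.ArchKTypeOfLineR1Family; RUN 51; INSTALL after #CA53 #CA54; drops ⇒ {#CA57}; cert certs/ax-ArchKTypeOfLineR2Family-53c2a2db991e.log: rc 0 / 18 s / 0 warnings / trio) (`HOME/mc/pub-hodgecm-mc-carch-1/pkg51/HodgeCM/Model/ArchKTypeOfLineR2Family.lean`, md5 53c2a2db991e, 177 lines);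
landed by the gen-20 packager (p-g20) in gate run 51 as `HodgeCM/Model/ArchKTypeOfLineR2Family.lean` (verbatim).
-/
/-
Copyright (c) 2026. Released under Apache 2.0 license as described in the file LICENSE.
Cell pub-hodgecm, MODEL layer (construction prover mc-carch-1, gen 5), BINDER-OWNERS row 12 `C`, pin R2 (conjugated lines 2, 3):
the second-twist family `ν'R` and row 12's four PROVE inputs (c5)₂/(c5)₃/(χ)₂/(χ)₃ as GUARDED FAMILY THEOREMS — the R2 twin of #CA35.
-/
import Summits.HodgeConjecture.HodgeCM.Model.ArchKTypeOfLineR2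
import Summits.HodgeConjecture.HodgeCM.Model.ArchKTypeOfSigmaConjHolds
import Summits.HodgeConjecture.HodgeCM.Model.ArchKTypeOfLineR1Family

/-!
# Pin R2 as guarded families: `n₃RF`, `ν₃R`, `ν'R`, and (c5)₂/(c5)₃/(χ)₂/(χ)₃ HYPOTHESIS-FREE under the OG guard

E's pins are families over `∀ {L} {ι₁} (V : HermSpace3 L ι₁) (c : SeesawCtx L)` guarded by `SInstance.GOG V c` (sinst #1212).  This leaf is the
R2 companion of #CA35 `ArchKTypeOfLineR1Family` (which built `χVR`, `ν₁R`, `νR` for lines 0, 1):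

* § 1 `SInstance.n₃RF @hGR₃ : ∀ {L ι₁} (V c), InfinitePlace L → ℤ` — carch's R2 table `n₃R` (#CA49) under the guard, `0` off it;
  `SInstance.ν₃R := EtaChi.χOfType n₃RF` (a unitary Hecke character of that type, unitary-1's device) and the bare-hom SECOND TWIST FAMILY
  **`SInstance.ν'R := νOf ν₃R : ∀ (V c), CMAdelic L (frameD V) →* ℂˣ`** with its slots `hν'R` (trivial on `CMRat`) / `hν'cR` (continuous) — exactly the
  `ν' hν' hν'c` arguments of period-1 #P50b `archSideOfT' V c … η hη hηc ν hν hνc ν' hν' hν'c h₁W A`; `hasArchType_ν₃R_of_GOG`.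
* § 2 AT THE R2 SPLIT `η₂ := etaT₂ … (EtaChi.η χVR χW V c) (ν'R V c)`, `η₃ := etaT₃ … (EtaChi.η χVR χW V c) (ν'R V c)` (ANY `χW` family), under
  `hG : GOG V c` and with NO further hypothesis:
  **`hdef_three_R2_of_GOG`**, **`hdef_two_R2_of_GOG`** — the `hdef` inputs of #CA44 `harch_three/two_of_defType(_coset)G` at the tables of record
  `defExponentThree/Two` ((c5)₃/(c5)₂; the R1/R2 consistency `nVR = nVR₂` off `v₁` is the THEOREM `nVR_eq_nVR₂_of_GOG_holds` of
  `ArchKTypeOfSigmaConjHolds`, i.e. #CA50 at sinst #1226 `hSV_holds`);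
  **`hχ_three_R2_of_GOG`**, **`hχ_two_R2_of_GOG`** — the `hχ` inputs of the k = 3, 2 At-terms #CA43/#CA47 ((χ)₃/(χ)₂; the `v₁` consistency
  `nVR (mk ι₁) = −eP² − eP³ − ℓ″` is the THEOREM `nVR_mk_eq_conj_of_GOG`, i.e. #CA52 at period-1 #P50c `exists_strip_vt_vacuum`).

So at the doubly twisted pin `archSideOfT' … (EtaChi.η χVR χW V c) … (νR V c) … (ν'R V c) …` ALL EIGHT row-12 PROVE inputs (c5)ₖ/(χ)ₖ, k = 0…3, are
kernel theorems: k = 0, 1 by #CA33/#CA34/#CA35 (sinst #1216 `hdef/hχ_zero/one_ROGTC`), k = 2, 3 here.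
0 records, 0 `def … : Prop`, nothing cited as a hypothesis; the only hypothesis is E's guard `GOG V c`.
-/

set_option autoImplicit false

noncomputable section

open NumberField NumberField.InfinitePlace
open scoped Matrix Classical
open Literature.Geometry.ComplexHyperbolic.BallModel (U21 x₀ stabilizerEquivK21)
open Literature.NumberTheory.Automorphic.U21 (matA sclD)
open Literature.NumberTheory.Automorphic Literature.NumberTheory.Automorphic.UnitaryGroup Literature.NumberTheory.Weil1964
open Literature.NumberTheory.GelbartRogawski1991 Literature.NumberTheory.GelbartRogawski1991.UnitaryDualPair
open HodgeCM.Adelic HodgeCM.PerL34 HodgeCM.Model.HypCensus HodgeCM.Model.ArchSideTerm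

namespace HodgeCM.Model.SInstance

open HodgeCM.Model

variable
  (hGR : ∀ {L : CMField} {ι₁ : L →+* ℂ} (V : HermSpace3 L ι₁) (c : SeesawCtx L),
    (cmSplittingDatum (L : Type) finProdFinEquiv (frameD V) (frameD_real V) (frameD_ne V) (dW c.D) (dW_real c.D)
      (dW_ne c.D)).CompatibleSplitting)
  (hGR₀ : ∀ {L : CMField} {ι₁ : L →+* ℂ} (V : HermSpace3 L ι₁) (c : SeesawCtx L),
    (cmSplittingDatum (L : Type) (ArchSideTerm.e₁) (frameD V) (frameD_real V) (frameD_ne V) (lineVec (L : Type) (dW c.D 0))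
      (fun _ => dW_real c.D 0) (fun _ => dW_ne c.D 0)).CompatibleSplitting)
  (hGR₁ : ∀ {L : CMField} {ι₁ : L →+* ℂ} (V : HermSpace3 L ι₁) (c : SeesawCtx L),
    (cmSplittingDatum (L : Type) (ArchSideTerm.e₁) (frameD V) (frameD_real V) (frameD_ne V) (lineVec (L : Type) (dW c.D 1))
      (fun _ => dW_real c.D 1) (fun _ => dW_ne c.D 1)).CompatibleSplitting)
  (hGR₂ : ∀ {L : CMField} {ι₁ : L →+* ℂ} (V : HermSpace3 L ι₁) (c : SeesawCtx L),
    (cmSplittingDatum (L : Type) (ArchSideTerm.e₁) (frameD V) (frameD_real V) (frameD_ne V) (lineVec (L : Type) (dW' c.D 0))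
      (fun _ => dW'_real c.D 0) (fun _ => dW'_ne c.D 0)).CompatibleSplitting)
  (hGR₃ : ∀ {L : CMField} {ι₁ : L →+* ℂ} (V : HermSpace3 L ι₁) (c : SeesawCtx L),
    (cmSplittingDatum (L : Type) (ArchSideTerm.e₁) (frameD V) (frameD_real V) (frameD_ne V) (lineVec (L : Type) (dW' c.D 1))
      (fun _ => dW'_real c.D 1) (fun _ => dW'_ne c.D 1)).CompatibleSplitting)
  (χW : ∀ {L : CMField} {ι₁ : L →+* ℂ} (_V : HermSpace3 L ι₁) (_c : SeesawCtx L),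
    ContinuousMonoidHom (Literature.NumberTheory.Automorphic.relNormOneIdeles (↥(NumberField.maximalRealSubfield (L : Type))) (L : Type) ⧸
      Literature.NumberTheory.Automorphic.relNormOneRat (↥(NumberField.maximalRealSubfield (L : Type))) (L : Type)) Circle)

/-! ## § 1 The second-twist family of pin R2 -/

/-- **the `ν′`-type family of pin R2**: carch's table `n₃R` (#CA49: `−eP³` at `w(ι₁)`, `−a₃(b)` over a real `b ≠ v₁`) under the guard, `0` off it. -/
def n₃RF : ∀ {L : CMField} {ι₁ : L →+* ℂ} (_V : HermSpace3 L ι₁) (_c : SeesawCtx L), InfinitePlace (L : Type) → ℤ :=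
  fun V c => if hG : GOG V c then n₃R V c (hGR₃ V c) (hpos_GOG V c hG).2.2.2 else 0

/-- (Ported verbatim from the HodgeCMPerL package; no docstring in the source.) -/
theorem n₃RF_of_GOG {L : CMField} {ι₁ : L →+* ℂ} (V : HermSpace3 L ι₁) (c : SeesawCtx L) (hG : GOG V c) :
    @n₃RF @hGR₃ _ _ V c = n₃R V c (hGR₃ V c) (hpos_GOG V c hG).2.2.2 := by
  unfold n₃RF; rw [dif_pos hG]

/-- **`ν₃R := χOfType n₃RF`** — the unitary Hecke character behind the second twist of pin R2. -/
abbrev ν₃R : ∀ {L : CMField} {ι₁ : L →+* ℂ} (_V : HermSpace3 L ι₁) (_c : SeesawCtx L),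
    ContinuousMonoidHom (Literature.NumberTheory.Automorphic.relNormOneIdeles (↥(NumberField.maximalRealSubfield (L : Type))) (L : Type) ⧸
      Literature.NumberTheory.Automorphic.relNormOneRat (↥(NumberField.maximalRealSubfield (L : Type))) (L : Type)) Circle :=
  @EtaChi.χOfType (@n₃RF @hGR₃)

/-- **`ν'R := νOf ν₃R`** — THE SECOND TWIST FAMILY of pin R2 as bare homs `U(V)(𝔸) →* ℂˣ` (the `ν'` slot of period-1 #P50b `archSideOfT'`). -/
def ν'R : ∀ {L : CMField} {ι₁ : L →+* ℂ} (V : HermSpace3 L ι₁) (_c : SeesawCtx L), CMAdelic (L : Type) (frameD V) →* ℂˣ :=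
  fun V c => νOf (@ν₃R @hGR₃) V c

/-- the `hν'` slot: `ν'R` is trivial on the rational torus. -/
theorem hν'R : ∀ {L : CMField} {ι₁ : L →+* ℂ} (V : HermSpace3 L ι₁) (c : SeesawCtx L),
    ∀ γU ∈ CMRat (L : Type) (frameD V), @ν'R @hGR₃ _ _ V c γU = 1 :=
  fun V c => hνOf (@ν₃R @hGR₃) V c

/-- the `hν'c` slot: `ν'R` is continuous. -/
theorem hν'cR : ∀ {L : CMField} {ι₁ : L →+* ℂ} (V : HermSpace3 L ι₁) (c : SeesawCtx L),
    Continuous fun v => ((@ν'R @hGR₃ _ _ V c v : ℂˣ) : ℂ) :=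
  fun V c => hνcOf (@ν₃R @hGR₃) V c

/-- (Ported verbatim from the HodgeCMPerL package; no docstring in the source.) -/
theorem ν'R_eq {L : CMField} {ι₁ : L →+* ℂ} (V : HermSpace3 L ι₁) (c : SeesawCtx L) : @ν'R @hGR₃ _ _ V c = νOf (@ν₃R @hGR₃) V c := rfl

/-- under the guard, `ν₃R` HAS the R2 type `n₃R` (the `hn₃` input of `ArchKTypeOfLineR2`). -/
theorem hasArchType_ν₃R_of_GOG {L : CMField} {ι₁ : L →+* ℂ} (V : HermSpace3 L ι₁) (c : SeesawCtx L) (hG : GOG V c) :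
    UnitaryLineChar.HasArchType (L : Type) (@ν₃R @hGR₃ _ _ V c) (n₃R V c (hGR₃ V c) (hpos_GOG V c hG).2.2.2) := by
  rw [← n₃RF_of_GOG @hGR₃ V c hG]
  exact EtaChi.hasArchType_χOfType _ V c

/-! ## § 2 Row 12's four PROVE inputs for lines 2, 3 at the R2 split, under the guard -/

/-- **(c5)₃ UNDER THE OG GUARD, HYPOTHESIS-FREE**: the `hdef` hypothesis of #CA44 `harch_three_of_defType(_coset)G` for
`η₃ := etaT₃ … (EtaChi.η χVR χW V c) (ν'R V c)` at `a := defExponentThree`. -/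
theorem hdef_three_R2_of_GOG {L : CMField} {ι₁ : L →+* ℂ} (V : HermSpace3 L ι₁) (c : SeesawCtx L) (hG : GOG V c) :
    ∀ b : {v : InfinitePlace ↥(maximalRealSubfield L) // v.IsReal}, b ≠ HypCensus.cmPlace (L : Type) ι₁ →
      ∀ u : UnitaryGroup.archLocal (L : Type) 3 (Matrix.diagonal (frameD V)) (cmPlaceOver (L : Type) b),
        ((archScalar_threeG V c.D (hGR V c) (hGR₂ V c) (hGR₃ V c)
            (etaT₃ V c.D (EtaChi.η (@χVR @hGR @hGR₀ @hGR₁) @χW V c) (νOf (@ν₃R @hGR₃) V c))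
            (UnitaryGroup.archSingle (↥(maximalRealSubfield L)) L (IsCMField.complexConj L) 3 (Matrix.diagonal (frameD V))
            (IsCMField.complexConj_ne_one L) (UnitaryGroup.complexConj_smul_infinitePlace (L : Type)) (cmPlaceOver (L : Type) b) u) : ℂˣ) : ℂ) *
          (((u : archLocal (L : Type) 3 (Matrix.diagonal (frameD V)) (cmPlaceOver (L : Type) b)) : GL (Fin 3) ℂ) : Matrix (Fin 3) (Fin 3) ℂ).det ^
            defExponentThree V c (hGR₃ V c) (hpos_GOG V c hG).2.2.2 b = 1 :=
  hdef_three_R2 (@χVR @hGR @hGR₀ @hGR₁) @χW (@ν₃R @hGR₃) V c (hGR V c) (hGR₂ V c) (hGR₃ V c) (hpos_GOG V c hG).2.2.2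
    (hasArchType_ν₃R_of_GOG @hGR₃ V c hG)

/-- **(c5)₂ UNDER THE OG GUARD, HYPOTHESIS-FREE**: the `hdef` hypothesis of #CA44 `harch_two_of_defType(_coset)G` for
`η₂ := etaT₂ … (EtaChi.η χVR χW V c) (ν'R V c)` at `a := defExponentTwo` — the SHARED `χVR` of type `nVR`, `ν₃R` of type `n₃R`, and the R1/R2
consistency `nVR = nVR₂` off `v₁` supplied by the THEOREM `nVR_eq_nVR₂_of_GOG_holds`. -/
theorem hdef_two_R2_of_GOG {L : CMField} {ι₁ : L →+* ℂ} (V : HermSpace3 L ι₁) (c : SeesawCtx L) (hG : GOG V c) :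
    ∀ b : {v : InfinitePlace ↥(maximalRealSubfield L) // v.IsReal}, b ≠ HypCensus.cmPlace (L : Type) ι₁ →
      ∀ u : UnitaryGroup.archLocal (L : Type) 3 (Matrix.diagonal (frameD V)) (cmPlaceOver (L : Type) b),
        ((archScalar_twoG V c.D (hGR V c) (hGR₂ V c) (hGR₃ V c)
            (etaT₂ V c.D (EtaChi.η (@χVR @hGR @hGR₀ @hGR₁) @χW V c) (νOf (@ν₃R @hGR₃) V c))
            (UnitaryGroup.archSingle (↥(maximalRealSubfield L)) L (IsCMField.complexConj L) 3 (Matrix.diagonal (frameD V))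
            (IsCMField.complexConj_ne_one L) (UnitaryGroup.complexConj_smul_infinitePlace (L : Type)) (cmPlaceOver (L : Type) b) u) : ℂˣ) : ℂ) *
          (((u : archLocal (L : Type) 3 (Matrix.diagonal (frameD V)) (cmPlaceOver (L : Type) b)) : GL (Fin 3) ℂ) : Matrix (Fin 3) (Fin 3) ℂ).det ^
            defExponentTwo V c (hGR₂ V c) (hpos_GOG V c hG).2.2.1 b = 1 :=
  hdef_two_R2 (@χVR @hGR @hGR₀ @hGR₁) @χW (@ν₃R @hGR₃) V c (hGR V c) (hGR₀ V c) (hGR₁ V c) (hGR₂ V c) (hGR₃ V c) (hG_GOG V c hG)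
    (hpos_GOG V c hG).1 (hpos_GOG V c hG).2.1 (hpos_GOG V c hG).2.2.1 (hpos_GOG V c hG).2.2.2
    (hasArchType_χVR_of_GOG @hGR @hGR₀ @hGR₁ V c hG) (hasArchType_ν₃R_of_GOG @hGR₃ V c hG)
    (fun _ hb => nVR_eq_nVR₂_of_GOG_holds @hGR @hGR₀ @hGR₁ @hGR₂ @hGR₃ V c hG hb)

/-- **(χ)₃ UNDER THE OG GUARD, HYPOTHESIS-FREE**: the `hχ` input of the k = 3 At-terms (#CA43/#CA47) for
`η₃ := etaT₃ … (EtaChi.η χVR χW V c) (ν'R V c)` at the exponent tuple of record `lineVacExponentsThree`. -/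
theorem hχ_three_R2_of_GOG {L : CMField} {ι₁ : L →+* ℂ} (V : HermSpace3 L ι₁) (c : SeesawCtx L) (hG : GOG V c)
    (u : MulAction.stabilizer U21 x₀) :
    ((lineScalar_three V c.D (hGR V c) (hGR₂ V c) (hGR₃ V c)
          (etaT₃ V c.D (EtaChi.η (@χVR @hGR @hGR₀ @hGR₁) @χW V c) (νOf (@ν₃R @hGR₃) V c)) (u : U21) : ℂˣ) : ℂ) *
        ((matA (stabilizerEquivK21.symm u)).det ^
            (lineVacExponentsThree V c (hGR₃ V c) (posIdxEquivUnit (hpos_GOG V c hG).2.2.2) (negIdxEquivEmpty (hpos_GOG V c hG).2.2.2)).eP *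
          sclD (stabilizerEquivK21.symm u) ^
            (lineVacExponentsThree V c (hGR₃ V c) (posIdxEquivUnit (hpos_GOG V c hG).2.2.2) (negIdxEquivEmpty (hpos_GOG V c hG).2.2.2)).eQ) =
      star (sclD (stabilizerEquivK21.symm u)) :=
  hχ_three_R2 (@χVR @hGR @hGR₀ @hGR₁) @χW (@ν₃R @hGR₃) V c (hGR V c) (hGR₂ V c) (hGR₃ V c) (hpos_GOG V c hG).2.2.2 hG.1
    (hasArchType_ν₃R_of_GOG @hGR₃ V c hG) u

/-- **(χ)₂ UNDER THE OG GUARD, HYPOTHESIS-FREE**: the `hχ` input of the k = 2 At-terms (#CA43/#CA47) for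
`η₂ := etaT₂ … (EtaChi.η χVR χW V c) (ν'R V c)` at the exponent tuple of record `lineVacExponentsTwo` — the `v₁` consistency
`nVR (mk ι₁) = −eP² − eP³ − ℓ″` supplied by the THEOREM `nVR_mk_eq_conj_of_GOG`. -/
theorem hχ_two_R2_of_GOG {L : CMField} {ι₁ : L →+* ℂ} (V : HermSpace3 L ι₁) (c : SeesawCtx L) (hG : GOG V c)
    (u : MulAction.stabilizer U21 x₀) :
    ((lineScalar_two V c.D (hGR V c) (hGR₂ V c) (hGR₃ V c)
          (etaT₂ V c.D (EtaChi.η (@χVR @hGR @hGR₀ @hGR₁) @χW V c) (νOf (@ν₃R @hGR₃) V c)) (u : U21) : ℂˣ) : ℂ) *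
        ((matA (stabilizerEquivK21.symm u)).det ^
            (lineVacExponentsTwo V c (hGR₂ V c) (posIdxEquivUnit (hpos_GOG V c hG).2.2.1) (negIdxEquivEmpty (hpos_GOG V c hG).2.2.1)).eP *
          sclD (stabilizerEquivK21.symm u) ^
            (lineVacExponentsTwo V c (hGR₂ V c) (posIdxEquivUnit (hpos_GOG V c hG).2.2.1) (negIdxEquivEmpty (hpos_GOG V c hG).2.2.1)).eQ) =
      star (sclD (stabilizerEquivK21.symm u)) :=
  hχ_two_R2 (@χVR @hGR @hGR₀ @hGR₁) @χW (@ν₃R @hGR₃) V c (hGR V c) (hGR₀ V c) (hGR₁ V c) (hGR₂ V c) (hGR₃ V c) (hG_GOG V c hG)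
    (hpos_GOG V c hG).1 (hpos_GOG V c hG).2.1 (hpos_GOG V c hG).2.2.1 (hpos_GOG V c hG).2.2.2 hG.1
    (hasArchType_χVR_of_GOG @hGR @hGR₀ @hGR₁ V c hG) (hasArchType_ν₃R_of_GOG @hGR₃ V c hG)
    (nVR_mk_eq_conj_of_GOG @hGR @hGR₀ @hGR₁ @hGR₂ @hGR₃ V c hG) u

/-- read-back: the `ν'` slot of the R2 family IS `νOf ν₃R` applied (for rewriting `archSideOfT' … (ν'R V c) …` statements into the § 2 shape). -/
theorem ν'R_apply {L : CMField} {ι₁ : L →+* ℂ} (V : HermSpace3 L ι₁) (c : SeesawCtx L) (x : CMAdelic (L : Type) (frameD V)) :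
    @ν'R @hGR₃ _ _ V c x = νOf (@ν₃R @hGR₃) V c x := rfl

end HodgeCM.Model.SInstance

end
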